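import Literature.MathematicalPhysics.QuantumFieldTheory.Balaban1983to89.T4MatchingClosureRem
import Literature.MathematicalPhysics.QuantumFieldTheory.Balaban1983to89.TreeLengthDichotomy

/-!
# `Balaban1983to89.T4BankAgeYoung` — LEMMA Y (young locality of the NE7b-rem booking), KERNEL SKELETON
(cell `pub-balaban`, rung (B)+1, node U5; record `t4/T4-EST-U5E-rem.md` v1.1 §4 (unit `b2b-balaban-pv25`);
consumer `T4MatchingClosureRem` §5–§8 (unit `b2b-balaban-pv02` gen 8, p181923); journal CLAIM
T4-U5.E-REM-LEMMAY-K* 2026-08-19T02:44:02Z, unit `b2b-balaban-pv25` gen 6)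

HONEST FRAMING (cell `pub-balaban`, T4-DAG PAGE 1).  The cell's T4 target is the existence AND uniqueness of the
continuum limit of Bałaban's unit-scale averaged loop expectations on a finite torus — strictly beyond ultraviolet
stability ([Balaban1989LargeFieldII] Thm 1 p. 355); it is NOT the Yang–Mills mass gap and NOT the Clay problem.  This
module is KERNEL ARITHMETIC ONLY.  It kernel-checks the ARITHMETIC SKELETON of the cell-analysis Lemma Y of record
`t4/T4-EST-U5E-rem.md` v1.1 §4 — the YOUNG-side locality statement of the (REM) packaging of the located remnant
estimate NE7b-rem: a sub-history whose combinatorial BANK is small, `b(h) < c_e·p̄₀·A`, was CREATED RECENTLY, within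
`A·N′_K(A)` steps, with an epoch allowance `N′_K(A)` that is poly-logarithmic in `K` — and it delivers the allowance in
exactly the shape the tree's consumer `T4MatchingClosureRem.summable_remnantYoungW` (binder `hW : SublinearWindow W`)
needs, BY NAME (`PolylogWindow`, `PolylogWindow.sublinear`, `polylogWindow_of_le`).  `T4RemnantBooking`'s and
`T4MatchingClosureRem`'s docstrings record Lemma Y as "cell analysis, NOT PRINTED, proved nowhere in the tree"; after
this module its steps (1), (2c), (3), (4), (5) and remark (Y3) are kernel arithmetic over HYPOTHESIS SHAPES, and what
remains analysis / reading is named precisely below.  Lemma Y is NOT a statement of [Balaban1989LargeFieldII]; print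
sums no histories.  NOTHING of [Balaban1989LargeFieldII], [Balaban1988Convergent] or [Balaban1987RG1] is asserted
here: every geometric or printed input enters as a binder, page numbers below are LOCATIONS (quotations, render-read,
are in the record's §1 L4–L6, L9), and there is no `[cite:]` tag in this file.

THE LEMMA (record §4, v1.1 wording, informal).  Let `h` be a sub-history of a component alive at a step `j ≤ K`, with
bank `b(h) = c_e·p̄₀·m(h) + c_s·p̄₀²·D(h)` (`m` = number of events — births after the foundation, renewals, mergers;
`D = Σ_births (d′ + 1)`), and suppose `b(h) < c_e·p̄₀·A`, `A ≥ 1`.  Then `h` was created after step `j − A·N′_K(A)`,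
`N′_K(A) = L·(x_K + log(1 + g_K²β′K) + 1)^{r₀} + A·log₂C_d + log₂A + c_d`, `x_K = log g_K⁻²`,
`c_d = log₂(2·14^d + 6d) + 2`, `C_d` the re-covering constant of the located inequality (α) p. 384.  PROOF SKELETON
and what this module makes of each step:
* (1) EVENTS [K, §1]: each event banks `≥ c_e·p̄₀`, so `m < A`; under (P5) `c_e ≤ c_s·p̄₀` also `D < A`
  (`events_lt_of_bank_lt`, `births_lt_of_bank_lt`).  The CREDITS themselves (births (1.81) p. 384, renewals p. 386,
  mergers (1.88) p. 387 — LOCATIONS) are the OLD side's S-steps of the record and are NOT used or asserted here: the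
  bank enters as the single inequality `c_e·p̄₀·m + c_s·p̄₀²·D ≤ b`.
* (2c) SIZE LEDGER [K, §2–§3]: a potential `Ψ` over the events with `Ψ_after ≤ C·Ψ_before + 2·14^d·F_e + 2d·|V_e|`,
  foundation `Ψ₀ ≤ 2·14^d·F₀`, `Σ F ≤ D`, `Σ|V_e| ≤ 2m + D` forces `Ψ ≤ C^m·(2·14^d·D + 2d(2m + D))` throughout
  (discrete Grönwall, `gronwall_pow`, `sizePotential_le`) and hence every size `≤ G(A) := C^A·(2·14^d + 6d)·A`
  (`ledger_le`).  The DERIVATION of the per-event inequality from the located (α)/(β) p. 384, (γ) p. 385, (1.84) p. 386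
  (record steps (2a)/(2b): nesting of the partitions, endpoint-removal induction, monotonicity of `d′`) is GEOMETRY,
  [analysis], and stays the hypothesis `hstep`; so does `hσ` (a domain's size is at most `C` times the potential at its
  epoch start, step (2a)).
* (3) EPOCH LENGTH [K arithmetic over two shapes, §4]: the halving shape of (β) — `d′` after `k > 1` event-free steps is
  `≤ 2^{−k}·σ` — together with the record's input (I1) in DICHOTOMY form "`d′ > 0 ⇒ d′ ≥ 1`" bounds the last index
  with `d′ > 0` by `1 + log₂G` (`lastPos_le_one_add_logb`; `B16Cor3Scales.age_le_size_of_halving` is the LINEAR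
  bound `k ≤ σ` from the same shape — here the logarithm is needed).  (I1) is no longer an input on the cell's MODEL
  of the linear size: for `d′ = TreeLength.treeLen` of the cover it IS `TreeLengthDichotomy.treeLen_pos_iff` (unit
  `b2b-balaban-b02` gen 9), discharged BY NAME in `lastPos_le_one_add_logb_treeLen`.  The printed horizon of p. 385
  (an event-free epoch started at scale `s` ends within "(last positive index) + R_s" steps — LOCATION; quoted in the
  record's L5) is the hypothesis shape `hlen`.
* (4) SCALES [K, §5]: `x_s ≤ x_K + log(1 + g_K²β′(K − s))` for `s ≤ K` IS the telescoped flow inequality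
  `B14.inv_sq_le_of_rg_upper` (typed (I.0.20) with `β ≤ β′` along the flow) read through `log`
  (`logInvSq_le_of_flow`), and `R_s ≤ L·(x_s + 1)^{r}` is the minimality in the typed (2.5) `B14.IsRj`
  (`isRj_le_mul_add_one_pow`; siblings `B14FlowStep.isRj_le_mul_logpow`, `B16Improved189.Rj_le_L_mul_pow` assume
  `x^r ≥ 1` instead of the `+1`); together `R_s ≤ windowMax L r x̄ c̄ K = L·(x̄ + log(1 + c̄K) + 1)^r` for any
  `x̄ ≥ x_K`, `c̄ ≥ g_K²β′` (`window_le_of_flow`).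
* (5) SUM [K, §6]: `m + 1 ≤ A` epochs of length `≤ 1 + log₂G + R_max` each give lifetime
  `n(h) < A·epochAllowance d C R_max A` (`lifetime_lt`; with the flow, `lifetime_lt_flow`) — the record's `N′_K(A)`
  with one unit of slack (`c_d`'s `+2` where `+1` suffices; kept as printed in the record).
* (Y3) SHAPE [K, §7]: with `A = A(K) = ageCut C′ K = ⌈C′·log(K+1)⌉` (`T4RemnantBooking.ageCut`) and `x̄, c̄` FIXED in
  `K` (the T4 regime: the unit-scale coupling is held in a fixed compact range while the cutoff is removed, so
  `x_K ≤ x̄`, `g_K²β′ ≤ c̄` uniformly), the young allowance `youngAllowance … K = A(K)·N′_K(A(K))` satisfies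
  `youngAllowance … K ≤ w + w·(log(K+2))^{max r 1 + 1}` (`youngAllowance_le`) — the record's exponent `1 + p`,
  `p = max(r₀, 1)` —, so every ℕ-valued window it dominates is `PolylogWindow _ (max r 1 + 1)`, hence
  `SublinearWindow`, hence `Summable (remnantYoungW θ Λ C_w W ·)` for every `0 < θ < 1`
  (`polylogWindow_of_le_youngAllowance`, `summable_remnantYoungW_of_le_youngAllowance`, and the canonical
  `youngWindow := ⌈youngAllowance⌉₊`).  The two cell readings of WHETHER a `K`-dependent allowance is needed at all
  (DIVERGENCE D-pv14.14: frozen credit ⇒ poly-log creep, vs scale-local credit ⇒ `(log log K)^{r}` or none) are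
  untouched: this module proves the poly-log allowance SUFFICES for the young side and is of the consumer's type;
  v1's fixed-`N′` window `N′·A(K)` (`T4MatchingClosureRem.polylogWindow_mul_ageCut`) corresponds to windows that do
  not creep along the log window of scales (`r = 0` or `c̄ = 0`) but is NOT this module's allowance "up to constants"
  [v1.1, advisory A2 of the cross-read, cell GAPS C-pv18g9-3]: the ledger growth `A·log₂C + log₂A` survives at
  `r = 0`, so `youngAllowance` has exponent `2` in `log(K+2)` where the fixed-`N′` window has exponent `1`.
NOT KERNEL here (stays [analysis]/[R] in the record, entered as binders): the bank credits (S-side), steps (2a)/(2b),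
the printed horizon, and the identification of the abstract ledger with Bałaban's R-operation sub-histories.
[v1.1: steps (2a)/(2b) and the enlargement inequality (γ) have since become kernel ON THE CELL'S MODEL in the sibling
leaves `T4SizeLedger` (p182963: the event inequality and the potential step, i.e. the shapes `hfound`/`hstep`),
`T4EpochSize` (p183023: (2a), with `b2b-balaban-b02`'s re-covering constant `10·126^d` for `C`, and the halving /
integrality shapes `hhalf`/`hint`) and `T4Enlargement` (p183277: (γ) on the collar model, with the constant `4·14^d` —
twice print's `2·14^d`, from the repaired lower half of (2.30)); they are NOT imported here (this module stays upstream
of them) and remain binders of `lifetime_lt`.  §9 below is what lets a new-part constant `q·(2·14^d)` (model: `q = 2`)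
feed `lifetime_lt`: rescale the birth masses and read (P5) as (P5_q) `q·c_e ≤ c_s·p̄₀` — conclusion unchanged.]

v1.1 (2026-08-19, unit `b2b-balaban-pv25` gen 6): APPEND-ONLY over v1 (p182815) — every v1 declaration unchanged;
docstring edits = this note, the bracket above, advisory A1 of the cross-read (cell GAPS C-pv18g9-3) at
`lastPos_le_one_add_logb_treeLen` and advisory A2 in remark (Y3); NEW §9 `lifetime_lt_rescaled`,
`lifetime_lt_flow_rescaled`, `lifetime_lt_youngWindow_rescaled` and the model instances `lifetime_lt_four`,
`lifetime_lt_youngWindow_four` (+ a non-vacuity example).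

ABSOLUTE RULE.  No printed statement is asserted; no `[cite:]` tag; page numbers are LOCATIONS.  Every declaration is
[folklore] arithmetic over Mathlib, `B14` (typed (2.5) `IsRj`, telescoped (I.0.20) `inv_sq_le_of_rg_upper`),
`TreeLengthDichotomy.treeLen_pos_iff`, `T4RemnantBooking.ageCut` and `T4MatchingClosureRem` §5–§6.  Imports:
`T4MatchingClosureRem` (the consumer) and `TreeLengthDichotomy` (the dichotomy); NEW leaf, nothing modified.
Rung-(B)+1 value = the young half of the NE7b-rem packaging is now a kernel implication from named hypothesis shapes
to the consumer's named binder; NOT an estimate of Bałaban's densities, NOT summit progress.  Unit `b2b-balaban-pv25`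
gen 6.
-/

open Finset _root_.Filter _root_.Topology

namespace Literature.MathematicalPhysics.QuantumFieldTheory.Balaban1983to89.T4BankAgeYoung

open T4MatchingClosure T4RemnantBooking T4MatchingClosureRem

/-! ## §1 Step (1): a small bank allows few events and thin births -/

section Bank

/-- Step (1): every event banks at least `c_e·p̄₀`, so `b < c_e·p̄₀·A` forces `m < A`. [folklore] -/
theorem events_lt_of_bank_lt {ce cs p₀ b : ℝ} {m D A : ℕ} (hce : 0 < ce) (hp : 0 < p₀) (hcs : 0 ≤ cs)
    (hb : ce * p₀ * m + cs * p₀ ^ 2 * D ≤ b) (hbA : b < ce * p₀ * A) : m < A := by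
  have h0 : 0 ≤ cs * p₀ ^ 2 * (D : ℝ) := by positivity
  have h1 : ce * p₀ * (m : ℝ) < ce * p₀ * A := by linarith
  have h2 : (m : ℝ) < A := lt_of_mul_lt_mul_left h1 (by positivity)
  exact_mod_cast h2

/-- Step (2), first line: under (P5) `c_e ≤ c_s·p̄₀` every birth unit banks at least `c_e·p̄₀` too, so
`b < c_e·p̄₀·A` forces `D < A`. [folklore] -/
theorem births_lt_of_bank_lt {ce cs p₀ b : ℝ} {m D A : ℕ} (hce : 0 < ce) (hp : 0 < p₀) (hP5 : ce ≤ cs * p₀)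
    (hb : ce * p₀ * m + cs * p₀ ^ 2 * D ≤ b) (hbA : b < ce * p₀ * A) : D < A := by
  have hD0 : (0 : ℝ) ≤ D := Nat.cast_nonneg D
  have hpD : 0 ≤ p₀ * (D : ℝ) := by positivity
  have h0 : ce * p₀ * (D : ℝ) ≤ cs * p₀ ^ 2 * D := by
    have := mul_le_mul_of_nonneg_right hP5 hpD
    nlinarith
  have hm0 : 0 ≤ ce * p₀ * (m : ℝ) := by positivity
  have h1 : ce * p₀ * (D : ℝ) < ce * p₀ * A := by linarith
  have h2 : (D : ℝ) < A := lt_of_mul_lt_mul_left h1 (by positivity)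
  exact_mod_cast h2

/-- (P5) with `c_e > 0`, `p̄₀ > 0` forces `c_s > 0`. [folklore] -/
theorem cs_pos_of_P5 {ce cs p₀ : ℝ} (hce : 0 < ce) (hp : 0 < p₀) (hP5 : ce ≤ cs * p₀) : 0 < cs := by
  rcases lt_or_ge 0 cs with h | h
  · exact h
  · nlinarith

end Bank

/-! ## §2 Step (2c): the size potential — a discrete Grönwall inequality -/

section Potential

/-- Discrete Grönwall: `Ψ_{i+1} ≤ C·Ψ_i + F_i` with `C ≥ 1`, `Ψ₀, F ≥ 0` gives `Ψ_m ≤ C^m·(Ψ₀ + Σ_{i<m} F_i)`.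
[folklore] -/
theorem gronwall_pow {C : ℝ} (hC : 1 ≤ C) {Ψ F : ℕ → ℝ} (hF : ∀ i, 0 ≤ F i)
    (hstep : ∀ i, Ψ (i + 1) ≤ C * Ψ i + F i) :
    ∀ m, Ψ m ≤ C ^ m * (Ψ 0 + ∑ i ∈ Finset.range m, F i) := by
  intro m
  induction m with
  | zero => simp
  | succ m ih =>
    have hC0 : 0 ≤ C := le_trans zero_le_one hC
    have hCm1 : (1 : ℝ) ≤ C ^ (m + 1) := one_le_pow₀ hC
    have h1 := mul_le_mul_of_nonneg_left ih hC0
    have h2 : F m ≤ C ^ (m + 1) * F m := le_mul_of_one_le_left (hF m) hCm1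
    calc Ψ (m + 1) ≤ C * Ψ m + F m := hstep m
      _ ≤ C * (C ^ m * (Ψ 0 + ∑ i ∈ Finset.range m, F i)) + C ^ (m + 1) * F m := by linarith
      _ = C ^ (m + 1) * (Ψ 0 + ∑ i ∈ Finset.range (m + 1), F i) := by
          rw [Finset.sum_range_succ, pow_succ]; ring

/-- Running form: `Ψ_t ≤ C^m·(Ψ₀ + Σ_{i<m} F_i)` for every `t ≤ m`. [folklore] -/
theorem gronwall_pow_le {C : ℝ} (hC : 1 ≤ C) {Ψ F : ℕ → ℝ} (hΨ0 : 0 ≤ Ψ 0) (hF : ∀ i, 0 ≤ F i)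
    (hstep : ∀ i, Ψ (i + 1) ≤ C * Ψ i + F i) {t m : ℕ} (htm : t ≤ m) :
    Ψ t ≤ C ^ m * (Ψ 0 + ∑ i ∈ Finset.range m, F i) := by
  refine (gronwall_pow hC hF hstep t).trans ?_
  have hC0 : 0 ≤ C := le_trans zero_le_one hC
  refine mul_le_mul (pow_le_pow_right₀ hC htm) ?_ ?_ (pow_nonneg hC0 _)
  · exact add_le_add le_rfl
      (Finset.sum_le_sum_of_subset_of_nonneg (Finset.range_mono htm) fun i _ _ => hF i)
  · exact add_nonneg hΨ0 (Finset.sum_nonneg fun i _ => hF i)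

/-- THE SIZE LEDGER (record step (2c)): a potential with foundation `Ψ₀ ≤ a·f₀`, event steps
`Ψ_{i+1} ≤ C·Ψ_i + a·f_{i+1} + δ·v_{i+1}` over `m` events, totals `Σ_{i≤m} f_i ≤ D` (foundations and births) and
`Σ_{i≤m} v_i ≤ V` (pieces re-covered), is bounded THROUGHOUT by `C^m·(a·D + δ·V)`.  In Lemma Y: `a = 2·14^d`,
`δ = 2d`, `V = 2m + D`. [folklore] -/
theorem sizePotential_le {C a δ : ℝ} (hC : 1 ≤ C) (ha : 0 ≤ a) (hδ : 0 ≤ δ) {Ψ f v : ℕ → ℝ}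
    (hf : ∀ i, 0 ≤ f i) (hv : ∀ i, 0 ≤ v i) (hΨ0 : 0 ≤ Ψ 0) (hfound : Ψ 0 ≤ a * f 0)
    (hstep : ∀ i, Ψ (i + 1) ≤ C * Ψ i + (a * f (i + 1) + δ * v (i + 1)))
    {m : ℕ} {D V : ℝ} (hD : ∑ i ∈ Finset.range (m + 1), f i ≤ D) (hV : ∑ i ∈ Finset.range (m + 1), v i ≤ V)
    {t : ℕ} (ht : t ≤ m) : Ψ t ≤ C ^ m * (a * D + δ * V) := by
  have hF : ∀ i, 0 ≤ a * f (i + 1) + δ * v (i + 1) := fun i =>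
    add_nonneg (mul_nonneg ha (hf _)) (mul_nonneg hδ (hv _))
  have h := gronwall_pow_le hC hΨ0 hF hstep ht
  have ef : ∑ i ∈ Finset.range (m + 1), f i = (∑ i ∈ Finset.range m, f (i + 1)) + f 0 :=
    Finset.sum_range_succ' _ _
  have ev : ∑ i ∈ Finset.range (m + 1), v i = (∑ i ∈ Finset.range m, v (i + 1)) + v 0 :=
    Finset.sum_range_succ' _ _
  have hv0 := hv 0
  have hsum : Ψ 0 + ∑ i ∈ Finset.range m, (a * f (i + 1) + δ * v (i + 1)) ≤ a * D + δ * V := by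
    rw [Finset.sum_add_distrib, ← Finset.mul_sum, ← Finset.mul_sum]
    have h1 : a * f 0 + a * ∑ i ∈ Finset.range m, f (i + 1) ≤ a * D := by
      rw [← mul_add]; exact mul_le_mul_of_nonneg_left (by linarith) ha
    have h2 : δ * ∑ i ∈ Finset.range m, v (i + 1) ≤ δ * V :=
      mul_le_mul_of_nonneg_left (by linarith) hδ
    linarith
  exact h.trans (mul_le_mul_of_nonneg_left hsum (pow_nonneg (le_trans zero_le_one hC) _))

end Potential

/-! ## §3 The size ceiling `G(A) = C^A·(2·14^d + 6d)·A` and its logarithm -/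

section Ledger

/-- With `m < A`, `D < A`, `C ≥ 1`: `C^{m+1}·(2·14^d·D + 2d(2m + D)) ≤ C^A·((2·14^d + 6d)·A)`. [folklore] -/
theorem ledger_le {C : ℝ} (hC : 1 ≤ C) {d m D A : ℕ} (hm : m < A) (hD : D < A) :
    C ^ (m + 1) * (2 * 14 ^ d * (D : ℝ) + 2 * d * (2 * m + D)) ≤ C ^ A * ((2 * 14 ^ d + 6 * d) * A) := by
  have hC0 : 0 ≤ C := le_trans zero_le_one hC
  have hmA : (m : ℝ) + 1 ≤ A := by exact_mod_cast Nat.succ_le_of_lt hm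
  have hDA : (D : ℝ) ≤ A := by exact_mod_cast hD.le
  have hd0 : (0 : ℝ) ≤ d := Nat.cast_nonneg d
  have hD0 : (0 : ℝ) ≤ D := Nat.cast_nonneg D
  have hm0 : (0 : ℝ) ≤ m := Nat.cast_nonneg m
  have h14 : (0 : ℝ) ≤ 2 * 14 ^ d := by positivity
  have h1 : C ^ (m + 1) ≤ C ^ A := pow_le_pow_right₀ hC (Nat.succ_le_of_lt hm)
  have h2 : 2 * 14 ^ d * (D : ℝ) + 2 * d * (2 * m + D) ≤ (2 * 14 ^ d + 6 * d) * A := by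
    have e1 : 2 * 14 ^ d * (D : ℝ) ≤ 2 * 14 ^ d * A := mul_le_mul_of_nonneg_left hDA h14
    have e2 : 2 * (d : ℝ) * (2 * m + D) ≤ 2 * d * (3 * A) :=
      mul_le_mul_of_nonneg_left (by linarith) (by positivity)
    linarith
  have h3 : (0 : ℝ) ≤ 2 * 14 ^ d * (D : ℝ) + 2 * d * (2 * m + D) := by positivity
  exact mul_le_mul h1 h2 h3 (pow_nonneg hC0 _)

/-- `1 ≤ G(A)` for `C ≥ 1`, `A ≥ 1`. [folklore] -/
theorem one_le_ledger {C : ℝ} (hC : 1 ≤ C) (d : ℕ) {A : ℕ} (hA : 1 ≤ A) :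
    (1 : ℝ) ≤ C ^ A * ((2 * 14 ^ d + 6 * d) * A) := by
  have h1 : (1 : ℝ) ≤ C ^ A := one_le_pow₀ hC
  have hA' : (1 : ℝ) ≤ A := by exact_mod_cast hA
  have hd0 : (0 : ℝ) ≤ d := Nat.cast_nonneg d
  have h14 : (1 : ℝ) ≤ 14 ^ d := one_le_pow₀ (by norm_num)
  have h2 : (1 : ℝ) ≤ (2 * 14 ^ d + 6 * d) * A := by nlinarith
  nlinarith

/-- `log₂ G(A) = A·log₂C + log₂(2·14^d + 6d) + log₂A` (`C > 0`, `A > 0`). [folklore] -/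
theorem logb_ledger {C c : ℝ} (hC : 0 < C) (hc : 0 < c) {A : ℕ} (hA : 0 < A) :
    Real.logb 2 (C ^ A * (c * A)) = A * Real.logb 2 C + Real.logb 2 c + Real.logb 2 A := by
  have hA' : (0 : ℝ) < A := by exact_mod_cast hA
  rw [Real.logb_mul (by positivity) (by positivity), Real.logb_mul hc.ne' hA'.ne']
  simp only [← Real.log_div_log]
  rw [Real.log_pow]
  ring

end Ledger

/-! ## §4 Step (3): epoch length from halving and integrality -/

section Epoch

/-- Halving + dichotomy: if the profile `d′` (a linear size along the event-free steps) takes no value in `]0, 1[`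
(`0 < d′_k → 1 ≤ d′_k`, the shape of `TreeLengthDichotomy.treeLen_pos_iff`), satisfies `d′_k ≤ 2^{−k}·σ` for
`k > 1`, and `σ ≤ G`, `G ≥ 1`, then every index `k` with `d′_k > 0` — or `k = 0` — satisfies `k ≤ 1 + log₂G`.
(Compare `B16Cor3Scales.age_le_size_of_halving`: the LINEAR bound `k ≤ σ` from the same shape; Lemma Y needs the
logarithm.) [folklore] -/
theorem lastPos_le_one_add_logb {σ G : ℝ} (hσG : σ ≤ G) (hG : 1 ≤ G) {d' : ℕ → ℝ}
    (hint : ∀ k, 0 < d' k → 1 ≤ d' k) (hβ : ∀ k, 1 < k → d' k ≤ (1 / 2) ^ k * σ) {k : ℕ}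
    (hk : k = 0 ∨ 0 < d' k) : (k : ℝ) ≤ 1 + Real.logb 2 G := by
  have hlogG : 0 ≤ Real.logb 2 G := Real.logb_nonneg one_lt_two hG
  rcases Nat.lt_or_ge 1 k with hk1 | hk1
  swap
  · have : (k : ℝ) ≤ 1 := by exact_mod_cast hk1
    linarith
  · have hpos : 0 < d' k := by
      rcases hk with h | h
      · omega
      · exact h
    have h1 : (1 : ℝ) ≤ (1 / 2) ^ k * σ := le_trans (hint k hpos) (hβ k hk1)
    have h2p : (0 : ℝ) < 2 ^ k := by positivity
    have hσ : (2 : ℝ) ^ k ≤ σ := by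
      have e : (1 / 2 : ℝ) ^ k * σ = σ / 2 ^ k := by
        rw [div_pow, one_pow, div_mul_eq_mul_div, one_mul]
      rw [e, le_div_iff₀ h2p, one_mul] at h1
      exact h1
    have hGk : (2 : ℝ) ^ k ≤ G := hσ.trans hσG
    have hG0 : 0 < G := lt_of_lt_of_le h2p hGk
    have h3 : (k : ℝ) ≤ Real.logb 2 G := by
      rw [Real.le_logb_iff_rpow_le one_lt_two hG0, Real.rpow_natCast]
      exact hGk
    linarith

/-- The record's input (I1), DISCHARGED ON THE CELL's MODEL of the linear size: when the profile is the linear size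
`TreeLength.treeLen` of a sequence of cube sets (the covers `Z^{(k)}` of an event-free epoch), the dichotomy
hypothesis of `lastPos_le_one_add_logb` IS `TreeLengthDichotomy.treeLen_pos_iff` (unit `b2b-balaban-b02` gen 9);
only the halving shape of the located (β) and `σ ≤ G` remain hypotheses.  RESIDUAL AT THIS POINT OF DISCHARGE [v1.1,
advisory A1 of the cross-read, cell GAPS C-pv18g9-3]: the identification of print's linear size `d′` (B16 (1.60);
[I] p. 257) with `TreeLength.treeLen` of the model's cube sets is a standing READING of the cell (`TreeLength`'s
citation header), not a theorem; the dichotomy is discharged for `treeLen`, and only for it. [folklore] -/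
theorem lastPos_le_one_add_logb_treeLen {dd : ℕ} (Z : ℕ → Finset (B13ScaleTransfer.Pt dd)) {σ G : ℝ}
    (hσG : σ ≤ G) (hG : 1 ≤ G) (hβ : ∀ k, 1 < k → TreeLength.treeLen (Z k) ≤ (1 / 2) ^ k * σ) {k : ℕ}
    (hk : k = 0 ∨ 0 < TreeLength.treeLen (Z k)) : (k : ℝ) ≤ 1 + Real.logb 2 G :=
  lastPos_le_one_add_logb hσG hG (d' := fun k => TreeLength.treeLen (Z k))
    (fun k h => (TreeLengthDichotomy.treeLen_pos_iff (Z k)).mp h) hβ hk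

end Epoch

/-! ## §5 Step (4): windows along the log window of scales -/

section Scales

/-- Minimality in the typed (2.5) `B14.IsRj` (`R = L^s` for the least `s` with `L^s ≥ x^r`, `x = log g⁻²`):
`R ≤ L·(x + 1)^r` whenever `x ≥ 0` (the `+1` absorbs the case `x^r < 1`; siblings with the hypothesis `x^r ≥ 1`
instead: `B14FlowStep.isRj_le_mul_logpow`, `B16Improved189.Rj_le_L_mul_pow`). [folklore] -/
theorem isRj_le_mul_add_one_pow {L r : ℕ} (hL : 1 ≤ L) {g : ℝ} {R : ℕ} (hR : B14.IsRj L r g R)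
    (hx : 0 ≤ Real.log (g ^ 2)⁻¹) : (R : ℝ) ≤ L * (Real.log (g ^ 2)⁻¹ + 1) ^ r := by
  obtain ⟨s, hRs, _, hmin⟩ := hR
  set x := Real.log (g ^ 2)⁻¹ with hxdef
  have hL1 : (1 : ℝ) ≤ L := by exact_mod_cast hL
  have hL0 : (0 : ℝ) ≤ L := le_trans zero_le_one hL1
  have hx1 : (1 : ℝ) ≤ (x + 1) ^ r := one_le_pow₀ (by linarith)
  have hxr : x ^ r ≤ (x + 1) ^ r := pow_le_pow_left₀ hx (by linarith) r
  rcases Nat.eq_zero_or_pos s with hs | hs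
  · rw [hRs, hs]
    simp only [pow_zero, Nat.cast_one]
    calc (1 : ℝ) = 1 * 1 := by ring
      _ ≤ (L : ℝ) * (x + 1) ^ r := mul_le_mul hL1 hx1 zero_le_one hL0
  · have hnot : ¬ (s ≤ s - 1) := by omega
    have hgt : ((L ^ (s - 1) : ℕ) : ℝ) < x ^ r := not_le.mp (fun h => hnot (hmin (s - 1) h))
    have e : (R : ℝ) = (L : ℝ) * ((L ^ (s - 1) : ℕ) : ℝ) := by
      rw [hRs]; push_cast
      rw [← pow_succ']; congr 1; omega
    rw [e]
    exact mul_le_mul_of_nonneg_left (hgt.le.trans hxr) hL0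

/-- `log` of the telescoped flow inequality: `1/g_s² ≤ 1/g_K² + β′t` (`β′t ≥ 0`) gives
`x_s ≤ x_K + log(1 + g_K²β′t)`. [folklore] -/
theorem logInvSq_le_of_invSq_le {gs gK β' t : ℝ} (hs : 0 < gs) (hK : 0 < gK) (ht : 0 ≤ β' * t)
    (h : 1 / gs ^ 2 ≤ 1 / gK ^ 2 + β' * t) :
    Real.log (gs ^ 2)⁻¹ ≤ Real.log (gK ^ 2)⁻¹ + Real.log (1 + gK ^ 2 * β' * t) := by
  have hK2 : 0 < gK ^ 2 := by positivity
  have hs2 : 0 < gs ^ 2 := by positivity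
  have hX : 0 ≤ gK ^ 2 * β' * t := by rw [mul_assoc]; exact mul_nonneg hK2.le ht
  have h2 : (gs ^ 2)⁻¹ ≤ (gK ^ 2)⁻¹ * (1 + gK ^ 2 * β' * t) := by
    have e : (gK ^ 2)⁻¹ * (1 + gK ^ 2 * β' * t) = 1 / gK ^ 2 + β' * t := by
      field_simp
    rw [e, ← one_div]; exact h
  have h3 := Real.log_le_log (by positivity) h2
  rw [Real.log_mul (ne_of_gt (by positivity)) (ne_of_gt (by linarith))] at h3
  exact h3

/-- Step (4), first half: along a flow obeying (I.0.20) up to `K` with `β_{j+1}(g_j) ≤ β′` (`β′ ≥ 0`) and positive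
couplings, `x_s ≤ x_K + log(1 + g_K²β′K)` for every `s ≤ K` — `B14.inv_sq_le_of_rg_upper` read through `log`, the
lag `K − s` replaced by `K`. [folklore] -/
theorem logInvSq_le_of_flow (F : Flow) (K : ℕ) {β' : ℝ} (hβ' : 0 ≤ β')
    (hpos : ∀ j, j ≤ K → 0 < F.g j) (hrg : F.SatisfiesRG K) (hub : ∀ j, j < K → F.β (j + 1) (F.g j) ≤ β')
    {s : ℕ} (hs : s ≤ K) :
    Real.log ((F.g s) ^ 2)⁻¹ ≤ Real.log ((F.g K) ^ 2)⁻¹ + Real.log (1 + (F.g K) ^ 2 * β' * K) := by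
  have h := B14.inv_sq_le_of_rg_upper F K β' hrg hub s K hs le_rfl
  have hsK : (s : ℝ) ≤ K := by exact_mod_cast hs
  have hs0 : (0 : ℝ) ≤ s := Nat.cast_nonneg s
  have ht : 0 ≤ β' * ((K : ℝ) - s) := mul_nonneg hβ' (by linarith)
  have h1 := logInvSq_le_of_invSq_le (hpos s hs) (hpos K le_rfl) ht h
  have hK2 : 0 ≤ (F.g K) ^ 2 * β' := mul_nonneg (sq_nonneg _) hβ'
  have hX : 0 ≤ (F.g K) ^ 2 * β' * ((K : ℝ) - s) := mul_nonneg hK2 (by linarith)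
  have h2 : Real.log (1 + (F.g K) ^ 2 * β' * ((K : ℝ) - s)) ≤ Real.log (1 + (F.g K) ^ 2 * β' * K) := by
    apply Real.log_le_log (by linarith)
    have : (F.g K) ^ 2 * β' * ((K : ℝ) - s) ≤ (F.g K) ^ 2 * β' * K :=
      mul_le_mul_of_nonneg_left (by linarith) hK2
    linarith
  linarith

/-- The UNIFORM window bound over the log window of scales (step (4)): `R_max(K) = L·(x̄ + log(1 + c̄·K) + 1)^r`,
`x̄ ≥ x_K = log g_K⁻²`, `c̄ ≥ g_K²β′`. [folklore] (a definition) -/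
noncomputable def windowMax (L r : ℕ) (x c : ℝ) (K : ℕ) : ℝ :=
  L * (x + Real.log (1 + c * K) + 1) ^ r

/-- `0 ≤ windowMax` for `x, c ≥ 0`. [folklore] -/
theorem windowMax_nonneg (L r : ℕ) {x c : ℝ} (hx : 0 ≤ x) (hc : 0 ≤ c) (K : ℕ) :
    0 ≤ windowMax L r x c K := by
  unfold windowMax
  have hK : (0 : ℝ) ≤ K := Nat.cast_nonneg K
  have : 0 ≤ Real.log (1 + c * K) := Real.log_nonneg (by nlinarith)
  positivity

/-- Step (4): along the flow, every window `R_s`, `s ≤ K`, of the typed (2.5) shape is at most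
`windowMax L r x̄ c̄ K` for any `x̄ ≥ log g_K⁻²`, `c̄ ≥ g_K²β′` (couplings in `]0, 1]`). [folklore] -/
theorem window_le_of_flow (F : Flow) (K : ℕ) {β' : ℝ} (hβ' : 0 ≤ β') {L r : ℕ} (hL : 1 ≤ L)
    (hpos : ∀ j, j ≤ K → 0 < F.g j) (hle1 : ∀ j, j ≤ K → F.g j ≤ 1) (hrg : F.SatisfiesRG K)
    (hub : ∀ j, j < K → F.β (j + 1) (F.g j) ≤ β') (R : ℕ → ℕ) (hR : ∀ j, j ≤ K → B14.IsRj L r (F.g j) (R j))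
    {x c : ℝ} (hxK : Real.log ((F.g K) ^ 2)⁻¹ ≤ x) (hcK : (F.g K) ^ 2 * β' ≤ c)
    {s : ℕ} (hs : s ≤ K) : (R s : ℝ) ≤ windowMax L r x c K := by
  have hgs : 0 < F.g s := hpos s hs
  have hxs : 0 ≤ Real.log ((F.g s) ^ 2)⁻¹ := by
    apply Real.log_nonneg
    rw [one_le_inv₀ (by positivity)]
    exact pow_le_one₀ hgs.le (hle1 s hs)
  have h1 := isRj_le_mul_add_one_pow hL (hR s hs) hxs
  have h2 := logInvSq_le_of_flow F K hβ' hpos hrg hub hs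
  have hK0 : (0 : ℝ) ≤ K := Nat.cast_nonneg K
  have hK2 : 0 ≤ (F.g K) ^ 2 * β' := mul_nonneg (sq_nonneg _) hβ'
  have hX : 0 ≤ (F.g K) ^ 2 * β' * K := mul_nonneg hK2 hK0
  have h3 : Real.log (1 + (F.g K) ^ 2 * β' * K) ≤ Real.log (1 + c * K) := by
    apply Real.log_le_log (by linarith)
    have : (F.g K) ^ 2 * β' * K ≤ c * K := mul_le_mul_of_nonneg_right hcK hK0
    linarith
  have hbase : Real.log ((F.g s) ^ 2)⁻¹ + 1 ≤ x + Real.log (1 + c * K) + 1 := by linarith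
  have hL0 : (0 : ℝ) ≤ L := Nat.cast_nonneg L
  unfold windowMax
  calc (R s : ℝ) ≤ L * (Real.log ((F.g s) ^ 2)⁻¹ + 1) ^ r := h1
    _ ≤ L * (x + Real.log (1 + c * K) + 1) ^ r :=
        mul_le_mul_of_nonneg_left (pow_le_pow_left₀ (by linarith) hbase r) hL0

end Scales

/-! ## §6 Step (5): the lifetime bound — LEMMA Y's kernel skeleton at a fixed step `K` -/

section Lifetime

/-- Record §4's epoch-length allowance `N′ = R_max + A·log₂C + log₂A + c_d`, `c_d = log₂(2·14^d + 6d) + 2`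
(`C` = the re-covering constant `C_d` of the located (α); `R_max` = the uniform window bound). [folklore]
(a definition) -/
noncomputable def epochAllowance (d : ℕ) (C Rmax : ℝ) (A : ℕ) : ℝ :=
  Rmax + A * Real.logb 2 C + Real.logb 2 A + (Real.logb 2 (2 * 14 ^ d + 6 * d) + 2)

/-- `0 ≤ log₂(2·14^d + 6d)`. [folklore] -/
theorem logb_cover_nonneg (d : ℕ) : 0 ≤ Real.logb 2 (2 * 14 ^ d + 6 * (d : ℝ)) := by
  apply Real.logb_nonneg one_lt_two
  have h14 : (1 : ℝ) ≤ 14 ^ d := one_le_pow₀ (by norm_num)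
  have hd0 : (0 : ℝ) ≤ d := Nat.cast_nonneg d
  linarith

/-- `R_max + 1 ≤ epochAllowance` (all other terms are `≥ 0` for `C ≥ 1`). [folklore] -/
theorem add_one_le_epochAllowance (d : ℕ) {C Rmax : ℝ} (hC : 1 ≤ C) (A : ℕ) :
    Rmax + 1 ≤ epochAllowance d C Rmax A := by
  unfold epochAllowance
  have h1 : 0 ≤ (A : ℝ) * Real.logb 2 C := mul_nonneg (Nat.cast_nonneg A) (Real.logb_nonneg one_lt_two hC)
  have h2 : 0 ≤ Real.logb 2 (A : ℝ) := by
    rcases Nat.eq_zero_or_pos A with hA | hA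
    · simp [hA]
    · exact Real.logb_nonneg one_lt_two (by exact_mod_cast hA)
  have h3 := logb_cover_nonneg d
  linarith

/-- Sum of at most `A` epochs of length `≤ N` each (`N ≥ 0`): lifetime `≤ A·N`. [folklore] -/
theorem sum_len_le {E A : ℕ} (hE : E ≤ A) {ℓ : ℕ → ℝ} {N : ℝ} (hN : 0 ≤ N) (hℓ : ∀ i, i < E → ℓ i ≤ N) :
    ∑ i ∈ Finset.range E, ℓ i ≤ A * N := by
  calc ∑ i ∈ Finset.range E, ℓ i ≤ ∑ _i ∈ Finset.range E, N :=
        Finset.sum_le_sum fun i hi => hℓ i (Finset.mem_range.mp hi)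
    _ = E * N := by rw [Finset.sum_const, Finset.card_range, nsmul_eq_mul]
    _ ≤ A * N := mul_le_mul_of_nonneg_right (by exact_mod_cast hE) hN

/-- **LEMMA Y, KERNEL SKELETON (at a fixed step; record `t4/T4-EST-U5E-rem.md` v1.1 §4 steps (1)–(5)).**
DATA of an abstract sub-history ledger: bank constants `c_e, c_s, p̄₀` with (P5) `c_e ≤ c_s·p̄₀`; `m` events and
birth total `D` with bank `c_e·p̄₀·m + c_s·p̄₀²·D ≤ b < c_e·p̄₀·A`; a size potential `Ψ` over the events
(foundation `Ψ₀ ≤ 2·14^d·f₀`, event steps `Ψ_{i+1} ≤ C·Ψ_i + 2·14^d·f_{i+1} + 2d·v_{i+1}`, `Σ_{i≤m} f_i ≤ D`,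
`Σ_{i≤m} v_i ≤ 2m + D`, `C ≥ 1` the re-covering constant — the shape derived in record steps (2a)/(2b) from the
located (α)/(γ)/(1.84), NOT asserted); `m + 1` event-free epochs `i = 0..m`, epoch `i` run by a lineage whose base
has size `σ_i ≤ C·Ψ_t` for some `t ≤ m` (step (2a)), a halving profile `d′_i` with no value in `]0, 1[`
(`TreeLengthDichotomy.treeLen_pos_iff` on the cell's model; `d′_i(k) ≤ 2^{−k}σ_i` for `k > 1`, shape of the located
(β)), and length `len_i ≤ k_i + R_i` for an index `k_i` that is `0` or has `d′_i(k_i) > 0` (shape of the printed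
horizon p. 385 — LOCATION) with window `R_i ≤ R_max`.  CONCLUSION: the
lifetime `Σ_{i≤m} len_i < A·epochAllowance d C R_max A` (= `A·N′` of the record, one unit of slack). [folklore] -/
theorem lifetime_lt
    {ce cs p₀ b : ℝ} {m D A : ℕ} (hce : 0 < ce) (hp : 0 < p₀) (hP5 : ce ≤ cs * p₀)
    (hb : ce * p₀ * m + cs * p₀ ^ 2 * D ≤ b) (hbA : b < ce * p₀ * A)
    {C : ℝ} (hC : 1 ≤ C) (d : ℕ) {Ψ f v : ℕ → ℝ} (hf : ∀ i, 0 ≤ f i) (hv : ∀ i, 0 ≤ v i) (hΨ0 : 0 ≤ Ψ 0)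
    (hfound : Ψ 0 ≤ 2 * 14 ^ d * f 0)
    (hstep : ∀ i, Ψ (i + 1) ≤ C * Ψ i + (2 * 14 ^ d * f (i + 1) + 2 * d * v (i + 1)))
    (hD : ∑ i ∈ Finset.range (m + 1), f i ≤ D) (hV : ∑ i ∈ Finset.range (m + 1), v i ≤ 2 * m + D)
    {σ R : ℕ → ℝ} {d' : ℕ → ℕ → ℝ} {len : ℕ → ℕ} {Rmax : ℝ} (hRmax : 0 ≤ Rmax)
    (hσ : ∀ i, i ≤ m → ∃ t, t ≤ m ∧ σ i ≤ C * Ψ t)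
    (hint : ∀ i, i ≤ m → ∀ k, 0 < d' i k → 1 ≤ d' i k)
    (hhalf : ∀ i, i ≤ m → ∀ k, 1 < k → d' i k ≤ (1 / 2) ^ k * σ i)
    (hlen : ∀ i, i ≤ m → ∃ k : ℕ, (k = 0 ∨ 0 < d' i k) ∧ (len i : ℝ) ≤ k + R i)
    (hR : ∀ i, i ≤ m → R i ≤ Rmax) :
    (∑ i ∈ Finset.range (m + 1), (len i : ℝ)) < A * epochAllowance d C Rmax A := by
  have hcs : 0 ≤ cs := (cs_pos_of_P5 hce hp hP5).le
  have hmA : m < A := events_lt_of_bank_lt hce hp hcs hb hbA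
  have hDA : D < A := births_lt_of_bank_lt hce hp hP5 hb hbA
  have hA1 : 1 ≤ A := Nat.succ_le_of_lt (lt_of_le_of_lt (Nat.zero_le m) hmA)
  have hA0 : (0 : ℝ) < A := by exact_mod_cast hA1
  have hC0 : 0 < C := lt_of_lt_of_le zero_lt_one hC
  -- the size ceiling
  set G : ℝ := C ^ A * ((2 * 14 ^ d + 6 * d) * A) with hGdef
  have hG1 : 1 ≤ G := one_le_ledger hC d hA1
  have hΨ : ∀ t, t ≤ m → Ψ t ≤ C ^ m * (2 * 14 ^ d * (D : ℝ) + 2 * d * (2 * m + D)) := fun t ht =>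
    sizePotential_le hC (by positivity) (by positivity) hf hv hΨ0 hfound hstep hD hV ht
  have hσG : ∀ i, i ≤ m → σ i ≤ G := by
    intro i hi
    obtain ⟨t, ht, hst⟩ := hσ i hi
    have h1 := mul_le_mul_of_nonneg_left (hΨ t ht) hC0.le
    have h2 := ledger_le hC (d := d) hmA hDA
    calc σ i ≤ C * Ψ t := hst
      _ ≤ C * (C ^ m * (2 * 14 ^ d * (D : ℝ) + 2 * d * (2 * m + D))) := h1
      _ = C ^ (m + 1) * (2 * 14 ^ d * (D : ℝ) + 2 * d * (2 * m + D)) := by rw [pow_succ]; ring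
      _ ≤ G := h2
  -- log₂ of the ceiling
  have hlogG : Real.logb 2 G = A * Real.logb 2 C + Real.logb 2 (2 * 14 ^ d + 6 * (d : ℝ)) + Real.logb 2 A := by
    have hc : (0 : ℝ) < 2 * 14 ^ d + 6 * d := by positivity
    exact logb_ledger hC0 hc hA1
  -- every epoch is short
  have hN : ∀ i, i < m + 1 → (len i : ℝ) ≤ epochAllowance d C Rmax A - 1 := by
    intro i hi
    have hi' : i ≤ m := Nat.lt_succ_iff.mp hi
    obtain ⟨k, hk, hki⟩ := hlen i hi'
    have hk' := lastPos_le_one_add_logb (hσG i hi') hG1 (hint i hi') (hhalf i hi') hk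
    have hRi := hR i hi'
    unfold epochAllowance
    linarith
  have hN0 : 0 ≤ epochAllowance d C Rmax A - 1 := by
    have := add_one_le_epochAllowance d hC A (Rmax := Rmax)
    linarith
  have hsum := sum_len_le (Nat.succ_le_of_lt hmA) hN0 hN
  have : (A : ℝ) * (epochAllowance d C Rmax A - 1) < A * epochAllowance d C Rmax A := by nlinarith
  exact lt_of_le_of_lt hsum this

/-- **LEMMA Y, KERNEL SKELETON, WITH THE FLOW (steps (1)–(5) with (4) discharged by `B14`).**  As `lifetime_lt`,
the windows now being the typed (2.5) windows `R(s_i)` at the epochs' start scales `s_i ≤ K` of a flow obeying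
(I.0.20) up to `K` with `β ≤ β′` and couplings in `]0, 1]`: the lifetime is `< A·epochAllowance d C (windowMax L r
x̄ c̄ K) A` for any `x̄ ≥ log g_K⁻²`, `c̄ ≥ g_K²β′`, `x̄, c̄ ≥ 0`. [folklore] -/
theorem lifetime_lt_flow
    {ce cs p₀ b : ℝ} {m D A : ℕ} (hce : 0 < ce) (hp : 0 < p₀) (hP5 : ce ≤ cs * p₀)
    (hb : ce * p₀ * m + cs * p₀ ^ 2 * D ≤ b) (hbA : b < ce * p₀ * A)
    {C : ℝ} (hC : 1 ≤ C) (d : ℕ) {Ψ f v : ℕ → ℝ} (hf : ∀ i, 0 ≤ f i) (hv : ∀ i, 0 ≤ v i) (hΨ0 : 0 ≤ Ψ 0)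
    (hfound : Ψ 0 ≤ 2 * 14 ^ d * f 0)
    (hstep : ∀ i, Ψ (i + 1) ≤ C * Ψ i + (2 * 14 ^ d * f (i + 1) + 2 * d * v (i + 1)))
    (hD : ∑ i ∈ Finset.range (m + 1), f i ≤ D) (hV : ∑ i ∈ Finset.range (m + 1), v i ≤ 2 * m + D)
    {σ : ℕ → ℝ} {d' : ℕ → ℕ → ℝ} {len : ℕ → ℕ}
    (hσ : ∀ i, i ≤ m → ∃ t, t ≤ m ∧ σ i ≤ C * Ψ t)
    (hint : ∀ i, i ≤ m → ∀ k, 0 < d' i k → 1 ≤ d' i k)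
    (hhalf : ∀ i, i ≤ m → ∀ k, 1 < k → d' i k ≤ (1 / 2) ^ k * σ i)
    -- the flow and the typed windows
    (F : Flow) (K : ℕ) {β' : ℝ} (hβ' : 0 ≤ β') {L r : ℕ} (hL : 1 ≤ L)
    (hpos : ∀ j, j ≤ K → 0 < F.g j) (hle1 : ∀ j, j ≤ K → F.g j ≤ 1) (hrg : F.SatisfiesRG K)
    (hub : ∀ j, j < K → F.β (j + 1) (F.g j) ≤ β') (R : ℕ → ℕ) (hRj : ∀ j, j ≤ K → B14.IsRj L r (F.g j) (R j))
    {x c : ℝ} (hx : 0 ≤ x) (hc : 0 ≤ c) (hxK : Real.log ((F.g K) ^ 2)⁻¹ ≤ x) (hcK : (F.g K) ^ 2 * β' ≤ c)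
    {s : ℕ → ℕ} (hs : ∀ i, i ≤ m → s i ≤ K)
    (hlen : ∀ i, i ≤ m → ∃ k : ℕ, (k = 0 ∨ 0 < d' i k) ∧ (len i : ℝ) ≤ k + R (s i)) :
    (∑ i ∈ Finset.range (m + 1), (len i : ℝ)) < A * epochAllowance d C (windowMax L r x c K) A :=
  lifetime_lt hce hp hP5 hb hbA hC d hf hv hΨ0 hfound hstep hD hV (R := fun i => (R (s i) : ℝ))
    (windowMax_nonneg L r hx hc K) hσ hint hhalf hlen
    (fun i hi => window_le_of_flow F K hβ' hL hpos hle1 hrg hub R hRj hxK hcK (hs i hi))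

end Lifetime

/-! ## §7 Remark (Y3): the young allowance `A(K)·N′_K(A(K))` is poly-logarithmic, hence a `SublinearWindow` -/

section Polylog

/-- Lemma Y's young allowance as a function of `K`: `W(K) = A(K)·N′_K(A(K))` with `A(K) = ageCut C′ K`,
`R_max = windowMax L r x̄ c̄ K` (`x̄, c̄` fixed in `K`). [folklore] (a definition) -/
noncomputable def youngAllowance (d L r : ℕ) (C C' x c : ℝ) (K : ℕ) : ℝ :=
  (ageCut C' K : ℝ) * epochAllowance d C (windowMax L r x c K) (ageCut C' K)

/-- `log₂ y ≤ 2y` for `y ≥ 0` (`log y ≤ y − 1`, `2·log 2 > 1`). [folklore] -/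
theorem logb_two_le_two_mul {y : ℝ} (hy : 0 ≤ y) : Real.logb 2 y ≤ 2 * y := by
  have hl2 : (1 : ℝ) / 2 < Real.log 2 := by
    have := Real.log_two_gt_d9; norm_num at this ⊢; linarith
  have hl2pos : 0 < Real.log 2 := by linarith
  rcases eq_or_lt_of_le hy with h | h
  · rw [← h]; simp
  · have h1 : Real.log y ≤ y := by have := Real.log_le_sub_one_of_pos h; linarith
    rw [← Real.log_div_log, div_le_iff₀ hl2pos]
    nlinarith

/-- `ageCut C′ K ≤ (C′ + 1)·(log(K+2) + 1)` (`C′ ≥ 0`). [folklore] -/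
theorem ageCut_le_mul {C' : ℝ} (hC' : 0 ≤ C') (K : ℕ) :
    (ageCut C' K : ℝ) ≤ (C' + 1) * (Real.log ((K : ℝ) + 2) + 1) := by
  have hK0 : (0 : ℝ) ≤ (K : ℝ) := Nat.cast_nonneg K
  have hK1 : (1 : ℝ) ≤ (K : ℝ) + 1 := by linarith
  have hx : 0 ≤ C' * Real.log ((K : ℝ) + 1) := mul_nonneg hC' (Real.log_nonneg hK1)
  have h1 : ((ageCut C' K : ℕ) : ℝ) ≤ C' * Real.log ((K : ℝ) + 1) + 1 := (Nat.ceil_lt_add_one hx).le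
  have h2 : Real.log ((K : ℝ) + 1) ≤ Real.log ((K : ℝ) + 2) := Real.log_le_log (by positivity) (by linarith)
  have hℓ0 : 0 ≤ Real.log ((K : ℝ) + 2) := Real.log_nonneg (by linarith)
  have h3 := mul_le_mul_of_nonneg_left h2 hC'
  nlinarith

/-- **(Y3): THE YOUNG ALLOWANCE IS POLY-LOGARITHMIC OF EXPONENT `max r 1 + 1`** (the record's `1 + p`,
`p = max(r₀, 1)`): `youngAllowance … K ≤ w + w·(log(K+2))^{max r 1 + 1}` for an explicit `w ≥ 0` depending only on
`(d, L, r, C, C′, x̄, c̄)` (`C ≥ 1`, `C′, x̄, c̄ ≥ 0`). [folklore] -/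
theorem youngAllowance_le (d L r : ℕ) {C C' x c : ℝ} (hC : 1 ≤ C) (hC' : 0 ≤ C') (hx : 0 ≤ x) (hc : 0 ≤ c) :
    ∃ w : ℝ, 0 ≤ w ∧
      ∀ K : ℕ, youngAllowance d L r C C' x c K ≤ w + w * Real.log ((K : ℝ) + 2) ^ (max r 1 + 1) := by
  -- the constants
  set κ₁ : ℝ := x + Real.log (1 + c) + 2 with hκ₁
  set cd : ℝ := Real.logb 2 (2 * 14 ^ d + 6 * (d : ℝ)) + 2 with hcd
  set κ₂ : ℝ := L * κ₁ ^ r + (C' + 1) * Real.logb 2 C + 2 * (C' + 1) + cd with hκ₂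
  set p : ℕ := max r 1 with hp
  have hlc : 0 ≤ Real.log (1 + c) := Real.log_nonneg (by linarith)
  have hκ₁0 : 0 ≤ κ₁ := by rw [hκ₁]; linarith
  have hcd0 : 0 ≤ cd := by rw [hcd]; linarith [logb_cover_nonneg d]
  have hlC : 0 ≤ Real.logb 2 C := Real.logb_nonneg one_lt_two hC
  have hL0 : (0 : ℝ) ≤ L := Nat.cast_nonneg L
  have hκ₂0 : 0 ≤ κ₂ := by rw [hκ₂]; positivity
  refine ⟨(C' + 1) * κ₂ * 2 ^ (p + 1), by positivity, fun K => ?_⟩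
  -- the variable v = log(K+2) + 1 ≥ 1
  set ℓ : ℝ := Real.log ((K : ℝ) + 2) with hℓ
  set v : ℝ := ℓ + 1 with hv
  have hK0 : (0 : ℝ) ≤ (K : ℝ) := Nat.cast_nonneg K
  have hℓ0 : 0 ≤ ℓ := Real.log_nonneg (by linarith)
  have hv1 : 1 ≤ v := by linarith
  have hv0 : 0 ≤ v := by linarith
  have hvp : ∀ i, i ≤ p → v ^ i ≤ v ^ p := fun i hi => pow_le_pow_right₀ hv1 hi
  have hvr : v ^ r ≤ v ^ p := hvp r (le_max_left _ _)
  have hv1p : v ≤ v ^ p := by simpa using hvp 1 (le_max_right _ _)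
  have h1p : (1 : ℝ) ≤ v ^ p := one_le_pow₀ hv1
  have hvp0 : 0 ≤ v ^ p := by positivity
  -- (i) the age cut
  have hA : (ageCut C' K : ℝ) ≤ (C' + 1) * v := ageCut_le_mul hC' K
  have hA0 : (0 : ℝ) ≤ (ageCut C' K : ℝ) := Nat.cast_nonneg _
  -- (ii) the window
  have hlog : Real.log (1 + c * K) ≤ Real.log (1 + c) + ℓ := by
    have h1 : 1 + c * (K : ℝ) ≤ (1 + c) * ((K : ℝ) + 2) := by nlinarith
    have h2 := Real.log_le_log (by nlinarith) h1
    rw [Real.log_mul (by linarith) (by linarith)] at h2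
    exact h2
  have hbase : x + Real.log (1 + c * K) + 1 ≤ κ₁ * v := by
    rw [hκ₁]
    have : x ≤ x * v := le_mul_of_one_le_right hx hv1
    have : Real.log (1 + c) ≤ Real.log (1 + c) * v := le_mul_of_one_le_right hlc hv1
    nlinarith
  have hbase0 : 0 ≤ x + Real.log (1 + c * K) + 1 := by
    have : 0 ≤ Real.log (1 + c * K) := Real.log_nonneg (by nlinarith)
    linarith
  have hW : windowMax L r x c K ≤ L * κ₁ ^ r * v ^ p := by
    unfold windowMax
    calc (L : ℝ) * (x + Real.log (1 + c * K) + 1) ^ r ≤ L * (κ₁ * v) ^ r :=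
          mul_le_mul_of_nonneg_left (pow_le_pow_left₀ hbase0 hbase r) hL0
      _ = L * κ₁ ^ r * v ^ r := by rw [mul_pow]; ring
      _ ≤ L * κ₁ ^ r * v ^ p := mul_le_mul_of_nonneg_left hvr (by positivity)
  -- (iii) the other terms of the epoch allowance
  have hT2 : (ageCut C' K : ℝ) * Real.logb 2 C ≤ (C' + 1) * Real.logb 2 C * v ^ p := by
    calc (ageCut C' K : ℝ) * Real.logb 2 C ≤ (C' + 1) * v * Real.logb 2 C :=
          mul_le_mul_of_nonneg_right hA hlC
      _ ≤ (C' + 1) * v ^ p * Real.logb 2 C :=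
          mul_le_mul_of_nonneg_right (mul_le_mul_of_nonneg_left hv1p (by linarith)) hlC
      _ = (C' + 1) * Real.logb 2 C * v ^ p := by ring
  have hT3 : Real.logb 2 (ageCut C' K : ℝ) ≤ 2 * (C' + 1) * v ^ p := by
    calc Real.logb 2 (ageCut C' K : ℝ) ≤ 2 * (ageCut C' K : ℝ) := logb_two_le_two_mul hA0
      _ ≤ 2 * ((C' + 1) * v) := by linarith
      _ ≤ 2 * ((C' + 1) * v ^ p) := by nlinarith
      _ = 2 * (C' + 1) * v ^ p := by ring
  have hT4 : cd ≤ cd * v ^ p := le_mul_of_one_le_right hcd0 h1p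
  have hE : epochAllowance d C (windowMax L r x c K) (ageCut C' K) ≤ κ₂ * v ^ p := by
    unfold epochAllowance
    rw [hκ₂]
    nlinarith
  have hE0 : 0 ≤ epochAllowance d C (windowMax L r x c K) (ageCut C' K) := by
    have := add_one_le_epochAllowance d hC (ageCut C' K) (Rmax := windowMax L r x c K)
    have := windowMax_nonneg L r hx hc K
    linarith
  -- (iv) assemble
  have hY : youngAllowance d L r C C' x c K ≤ (C' + 1) * κ₂ * v ^ (p + 1) := by
    unfold youngAllowance
    calc (ageCut C' K : ℝ) * epochAllowance d C (windowMax L r x c K) (ageCut C' K)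
        ≤ ((C' + 1) * v) * (κ₂ * v ^ p) := mul_le_mul hA hE hE0 (by positivity)
      _ = (C' + 1) * κ₂ * v ^ (p + 1) := by rw [pow_succ]; ring
  have hvpow : v ^ (p + 1) ≤ 2 ^ (p + 1) * (ℓ ^ (p + 1) + 1) := by
    have hlp : 0 ≤ ℓ ^ (p + 1) := pow_nonneg hℓ0 _
    have h2 : (0 : ℝ) ≤ 2 ^ (p + 1) := pow_nonneg zero_le_two _
    rcases le_total ℓ 1 with h | h
    · calc v ^ (p + 1) ≤ (2 : ℝ) ^ (p + 1) := pow_le_pow_left₀ hv0 (by linarith) _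
        _ ≤ 2 ^ (p + 1) * (ℓ ^ (p + 1) + 1) := le_mul_of_one_le_right h2 (by linarith)
    · calc v ^ (p + 1) ≤ (2 * ℓ) ^ (p + 1) := pow_le_pow_left₀ hv0 (by linarith) _
        _ = 2 ^ (p + 1) * ℓ ^ (p + 1) := mul_pow 2 ℓ _
        _ ≤ 2 ^ (p + 1) * (ℓ ^ (p + 1) + 1) := mul_le_mul_of_nonneg_left (by linarith) h2
  have hCκ : 0 ≤ (C' + 1) * κ₂ := by positivity
  calc youngAllowance d L r C C' x c K ≤ (C' + 1) * κ₂ * v ^ (p + 1) := hY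
    _ ≤ (C' + 1) * κ₂ * (2 ^ (p + 1) * (ℓ ^ (p + 1) + 1)) := mul_le_mul_of_nonneg_left hvpow hCκ
    _ = (C' + 1) * κ₂ * 2 ^ (p + 1) + (C' + 1) * κ₂ * 2 ^ (p + 1) * ℓ ^ (p + 1) := by ring

/-- `0 ≤ youngAllowance` (`C ≥ 1`, `x̄, c̄ ≥ 0`). [folklore] -/
theorem youngAllowance_nonneg (d L r : ℕ) {C C' x c : ℝ} (hC : 1 ≤ C) (hx : 0 ≤ x) (hc : 0 ≤ c) (K : ℕ) :
    0 ≤ youngAllowance d L r C C' x c K := by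
  unfold youngAllowance
  have h1 := add_one_le_epochAllowance d hC (ageCut C' K) (Rmax := windowMax L r x c K)
  have h2 := windowMax_nonneg L r hx hc K
  exact mul_nonneg (Nat.cast_nonneg _) (by linarith)

/-- **Every ℕ-valued window dominated by Lemma Y's allowance is `PolylogWindow _ (max r 1 + 1)`** — the entry
lemma `T4MatchingClosureRem.polylogWindow_of_le`. [folklore] -/
theorem polylogWindow_of_le_youngAllowance {W : ℕ → ℕ} (d L r : ℕ) {C C' x c : ℝ} (hC : 1 ≤ C)
    (hC' : 0 ≤ C') (hx : 0 ≤ x) (hc : 0 ≤ c) (hW : ∀ K, (W K : ℝ) ≤ youngAllowance d L r C C' x c K) :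
    PolylogWindow W (max r 1 + 1) := by
  obtain ⟨w, -, hw⟩ := youngAllowance_le d L r hC hC' hx hc
  exact polylogWindow_of_le (w₀ := w) (w₁ := w) fun K => (hW K).trans (hw K)

/-- … hence `SublinearWindow` (`PolylogWindow.sublinear`). [folklore] -/
theorem sublinearWindow_of_le_youngAllowance {W : ℕ → ℕ} (d L r : ℕ) {C C' x c : ℝ} (hC : 1 ≤ C)
    (hC' : 0 ≤ C') (hx : 0 ≤ x) (hc : 0 ≤ c) (hW : ∀ K, (W K : ℝ) ≤ youngAllowance d L r C C' x c K) :
    SublinearWindow W :=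
  (polylogWindow_of_le_youngAllowance d L r hC hC' hx hc hW).sublinear

/-- **… hence THE YOUNG REMNANT RATE WITH LEMMA Y's ALLOWANCE IS SUMMABLE for every `0 < θ < 1`** — the
consumer's `T4MatchingClosureRem.summable_remnantYoungW`, binder `hW` discharged. [folklore] -/
theorem summable_remnantYoungW_of_le_youngAllowance {W : ℕ → ℕ} (d L r : ℕ) {C C' x c : ℝ} (hC : 1 ≤ C)
    (hC' : 0 ≤ C') (hx : 0 ≤ x) (hc : 0 ≤ c) (hW : ∀ K, (W K : ℝ) ≤ youngAllowance d L r C C' x c K)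
    {θ Λ Cw : ℝ} (hθ : 0 < θ) (hθ1 : θ < 1) (hΛ : 1 ≤ Λ) (hCw : 0 ≤ Cw) :
    Summable (fun K => remnantYoungW θ Λ Cw W K) :=
  summable_remnantYoungW hθ hθ1 hΛ hCw (sublinearWindow_of_le_youngAllowance d L r hC hC' hx hc hW)

/-- The canonical ℕ-valued young window `⌈youngAllowance⌉`. [folklore] (a definition) -/
noncomputable def youngWindow (d L r : ℕ) (C C' x c : ℝ) (K : ℕ) : ℕ :=
  ⌈youngAllowance d L r C C' x c K⌉₊

/-- `youngWindow` is `PolylogWindow _ (max r 1 + 1)`. [folklore] -/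
theorem polylogWindow_youngWindow (d L r : ℕ) {C C' x c : ℝ} (hC : 1 ≤ C) (hC' : 0 ≤ C') (hx : 0 ≤ x)
    (hc : 0 ≤ c) : PolylogWindow (youngWindow d L r C C' x c) (max r 1 + 1) := by
  obtain ⟨w, -, hw⟩ := youngAllowance_le d L r hC hC' hx hc
  refine polylogWindow_of_le (w₀ := w + 1) (w₁ := w) fun K => ?_
  have h0 := youngAllowance_nonneg d L r hC hx hc K (C' := C')
  have h1 : ((youngWindow d L r C C' x c K : ℕ) : ℝ) ≤ youngAllowance d L r C C' x c K + 1 :=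
    (Nat.ceil_lt_add_one h0).le
  linarith [hw K]

/-- … and the young remnant rate with the canonical window is summable, `0 < θ < 1`. [folklore] -/
theorem summable_remnantYoungW_youngWindow (d L r : ℕ) {C C' x c : ℝ} (hC : 1 ≤ C) (hC' : 0 ≤ C')
    (hx : 0 ≤ x) (hc : 0 ≤ c) {θ Λ Cw : ℝ} (hθ : 0 < θ) (hθ1 : θ < 1) (hΛ : 1 ≤ Λ) (hCw : 0 ≤ Cw) :
    Summable (fun K => remnantYoungW θ Λ Cw (youngWindow d L r C C' x c) K) :=
  summable_remnantYoungW hθ hθ1 hΛ hCw (polylogWindow_youngWindow d L r hC hC' hx hc).sublinear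

/-- THE LINK (Y3) at a fixed `K`: under the hypotheses of `lifetime_lt_flow` with `A = ageCut C′ K`, the lifetime
is `< youngAllowance d L r C C′ x̄ c̄ K ≤ youngWindow … K` — the sub-history was created within the window the
summable young rate allows. [folklore] -/
theorem lifetime_lt_youngWindow
    {ce cs p₀ b : ℝ} {m D : ℕ} {C' : ℝ} {K : ℕ} (hce : 0 < ce) (hp : 0 < p₀) (hP5 : ce ≤ cs * p₀)
    (hb : ce * p₀ * m + cs * p₀ ^ 2 * D ≤ b) (hbA : b < ce * p₀ * (ageCut C' K))
    {C : ℝ} (hC : 1 ≤ C) (d : ℕ) {Ψ f v : ℕ → ℝ} (hf : ∀ i, 0 ≤ f i) (hv : ∀ i, 0 ≤ v i) (hΨ0 : 0 ≤ Ψ 0)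
    (hfound : Ψ 0 ≤ 2 * 14 ^ d * f 0)
    (hstep : ∀ i, Ψ (i + 1) ≤ C * Ψ i + (2 * 14 ^ d * f (i + 1) + 2 * d * v (i + 1)))
    (hD : ∑ i ∈ Finset.range (m + 1), f i ≤ D) (hV : ∑ i ∈ Finset.range (m + 1), v i ≤ 2 * m + D)
    {σ : ℕ → ℝ} {d' : ℕ → ℕ → ℝ} {len : ℕ → ℕ}
    (hσ : ∀ i, i ≤ m → ∃ t, t ≤ m ∧ σ i ≤ C * Ψ t)
    (hint : ∀ i, i ≤ m → ∀ k, 0 < d' i k → 1 ≤ d' i k)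
    (hhalf : ∀ i, i ≤ m → ∀ k, 1 < k → d' i k ≤ (1 / 2) ^ k * σ i)
    (F : Flow) {β' : ℝ} (hβ' : 0 ≤ β') {L r : ℕ} (hL : 1 ≤ L)
    (hpos : ∀ j, j ≤ K → 0 < F.g j) (hle1 : ∀ j, j ≤ K → F.g j ≤ 1) (hrg : F.SatisfiesRG K)
    (hub : ∀ j, j < K → F.β (j + 1) (F.g j) ≤ β') (R : ℕ → ℕ) (hRj : ∀ j, j ≤ K → B14.IsRj L r (F.g j) (R j))
    {x c : ℝ} (hx : 0 ≤ x) (hc : 0 ≤ c) (hxK : Real.log ((F.g K) ^ 2)⁻¹ ≤ x) (hcK : (F.g K) ^ 2 * β' ≤ c)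
    {s : ℕ → ℕ} (hs : ∀ i, i ≤ m → s i ≤ K)
    (hlen : ∀ i, i ≤ m → ∃ k : ℕ, (k = 0 ∨ 0 < d' i k) ∧ (len i : ℝ) ≤ k + R (s i)) :
    (∑ i ∈ Finset.range (m + 1), (len i : ℝ)) < youngAllowance d L r C C' x c K ∧
      (∑ i ∈ Finset.range (m + 1), (len i : ℝ)) < (youngWindow d L r C C' x c K : ℝ) := by
  have h := lifetime_lt_flow hce hp hP5 hb hbA hC d hf hv hΨ0 hfound hstep hD hV hσ hint hhalf F K hβ' hL hpos
    hle1 hrg hub R hRj hx hc hxK hcK hs hlen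
  refine ⟨h, lt_of_lt_of_le h (Nat.le_ceil _)⟩

end Polylog

/-! ## §8 Sanity: the hypotheses of the skeleton are jointly satisfiable (non-vacuity) -/

section Sanity

/-- SANITY (non-vacuity of `lifetime_lt`): the trivial ledger — no event, no birth mass, zero potential, one
epoch of length `0` — satisfies every hypothesis (with `c_e = c_s = p̄₀ = 1`, `b = 0`, `A = 1`, `C = 1`,
`R_max = 0`), and the conclusion reads `0 < epochAllowance d 1 0 1`. [folklore] -/
theorem lifetime_lt_nonvacuous (d : ℕ) :
    (∑ i ∈ Finset.range (0 + 1), ((fun _ : ℕ => (0 : ℕ)) i : ℝ)) < (1 : ℕ) * epochAllowance d 1 0 1 :=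
  lifetime_lt (ce := 1) (cs := 1) (p₀ := 1) (b := 0) (m := 0) (D := 0) (A := 1) one_pos one_pos (by norm_num)
    (by norm_num) (by norm_num) le_rfl d (Ψ := fun _ => 0) (f := fun _ => 0) (v := fun _ => 0)
    (fun _ => le_rfl) (fun _ => le_rfl) le_rfl (by norm_num) (fun _ => by norm_num) (by simp) (by simp)
    (σ := fun _ => 0) (R := fun _ => 0) (d' := fun _ _ => 0) (len := fun _ => 0) (Rmax := 0) le_rfl
    (fun i _ => ⟨0, le_rfl, by norm_num⟩) (fun i _ k h => absurd h (lt_irrefl _)) (fun i _ k _ => by simp)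
    (fun i _ => ⟨0, Or.inl rfl, by norm_num⟩) (fun _ _ => le_rfl)

/-- SANITY: the bank hypotheses with a GENUINE event budget are satisfiable and the conclusion of step (1) is
sharp in type: `m = 2` events, `D = 1`, `c_e = 1`, `c_s = 2`, `p̄₀ = 1`, bank `b = 4 < 1·1·5`, so `A = 5 > m, D`.
[folklore] -/
example : (2 : ℕ) < 5 ∧ (1 : ℕ) < 5 :=
  ⟨events_lt_of_bank_lt (ce := 1) (cs := 2) (p₀ := 1) (b := 4) (m := 2) (D := 1) (A := 5) one_pos one_pos
      (by norm_num) (by norm_num) (by norm_num),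
   births_lt_of_bank_lt (ce := 1) (cs := 2) (p₀ := 1) (b := 4) (m := 2) (D := 1) (A := 5) one_pos one_pos
      (by norm_num) (by norm_num) (by norm_num)⟩

end Sanity

/-! ## §9 (v1.1) Rescaled birth unit: a new-part constant `q·(2·14^d)` is absorbed into (P5)

On the cell's MODEL the enlargement inequality (γ) holds with `4·14^d` where print has `2·14^d` (sibling leaf
`T4Enlargement`, `hnew_collar_three`: the constant comes from the REPAIRED lower half of (2.30); record wording
"E = 4·14^d; only log₂E enters N′_K(A)"), so the foundation / event-step shapes arrive as `Ψ₀ ≤ q·(2·14^d)·f₀`,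
`Ψ_{i+1} ≤ C·Ψ_i + q·(2·14^d)·f_{i+1} + 2d·v_{i+1}` with `q = 2`.  Rescaling the birth masses `f ↦ q·f`, `D ↦ q·D`
and the birth credit `c_s ↦ c_s/q` turns these into the hypotheses of `lifetime_lt` VERBATIM: the bank inequality is
invariant (`(c_s/q)·p̄₀²·(q·D) = c_s·p̄₀²·D`), `Σ v ≤ 2m + D ≤ 2m + q·D`, and (P5) becomes (P5_q) `q·c_e ≤ c_s·p̄₀` — a
threshold of the printed TYPE (record §6: thresholds doubled, none new in kind).  The CONCLUSION is UNCHANGED: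
lifetime `< A·epochAllowance d C R_max A`.  Nothing printed is asserted. [folklore]
-/

section Rescale

/-- **LEMMA Y, KERNEL SKELETON, RESCALED BIRTH UNIT.**  As `lifetime_lt`, with the new-part constant `q·(2·14^d)`
(`q ≥ 1` a natural number) in `hfound`/`hstep` and (P5_q) `q·c_e ≤ c_s·p̄₀` in place of (P5); same conclusion.
Proof: `lifetime_lt` applied to `f ↦ q·f`, `D ↦ q·D`, `c_s ↦ c_s/q`. [folklore] -/
theorem lifetime_lt_rescaled
    {ce cs p₀ b : ℝ} {m D A : ℕ} {q : ℕ} (hq : 1 ≤ q) (hce : 0 < ce) (hp : 0 < p₀) (hP5q : q * ce ≤ cs * p₀)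
    (hb : ce * p₀ * m + cs * p₀ ^ 2 * D ≤ b) (hbA : b < ce * p₀ * A)
    {C : ℝ} (hC : 1 ≤ C) (d : ℕ) {Ψ f v : ℕ → ℝ} (hf : ∀ i, 0 ≤ f i) (hv : ∀ i, 0 ≤ v i) (hΨ0 : 0 ≤ Ψ 0)
    (hfound : Ψ 0 ≤ q * (2 * 14 ^ d) * f 0)
    (hstep : ∀ i, Ψ (i + 1) ≤ C * Ψ i + (q * (2 * 14 ^ d) * f (i + 1) + 2 * d * v (i + 1)))
    (hD : ∑ i ∈ Finset.range (m + 1), f i ≤ D) (hV : ∑ i ∈ Finset.range (m + 1), v i ≤ 2 * m + D)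
    {σ R : ℕ → ℝ} {d' : ℕ → ℕ → ℝ} {len : ℕ → ℕ} {Rmax : ℝ} (hRmax : 0 ≤ Rmax)
    (hσ : ∀ i, i ≤ m → ∃ t, t ≤ m ∧ σ i ≤ C * Ψ t)
    (hint : ∀ i, i ≤ m → ∀ k, 0 < d' i k → 1 ≤ d' i k)
    (hhalf : ∀ i, i ≤ m → ∀ k, 1 < k → d' i k ≤ (1 / 2) ^ k * σ i)
    (hlen : ∀ i, i ≤ m → ∃ k : ℕ, (k = 0 ∨ 0 < d' i k) ∧ (len i : ℝ) ≤ k + R i)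
    (hR : ∀ i, i ≤ m → R i ≤ Rmax) :
    (∑ i ∈ Finset.range (m + 1), (len i : ℝ)) < A * epochAllowance d C Rmax A := by
  have hq0 : (0 : ℝ) < q := Nat.cast_pos.mpr (by omega)
  have hq1 : (1 : ℝ) ≤ q := by exact_mod_cast hq
  have hP5' : ce ≤ cs / q * p₀ := by
    rw [div_mul_eq_mul_div, le_div_iff₀ hq0]
    linarith
  have hb' : ce * p₀ * m + cs / q * p₀ ^ 2 * ((q * D : ℕ) : ℝ) ≤ b := by
    have h1 : cs / q * p₀ ^ 2 * ((q * D : ℕ) : ℝ) = cs * p₀ ^ 2 * D := by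
      rw [Nat.cast_mul, div_mul_eq_mul_div, div_mul_eq_mul_div, div_eq_iff hq0.ne']
      ring
    rw [h1]
    exact hb
  have hf' : ∀ i, 0 ≤ (q : ℝ) * f i := fun i => mul_nonneg hq0.le (hf i)
  have hfound' : Ψ 0 ≤ 2 * 14 ^ d * ((q : ℝ) * f 0) :=
    hfound.trans (le_of_eq (by ring))
  have hstep' : ∀ i, Ψ (i + 1) ≤ C * Ψ i + (2 * 14 ^ d * ((q : ℝ) * f (i + 1)) + 2 * d * v (i + 1)) :=
    fun i => (hstep i).trans (le_of_eq (by ring))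
  have hD' : ∑ i ∈ Finset.range (m + 1), (q : ℝ) * f i ≤ ((q * D : ℕ) : ℝ) := by
    rw [← Finset.mul_sum, Nat.cast_mul]
    exact mul_le_mul_of_nonneg_left hD hq0.le
  have hV' : ∑ i ∈ Finset.range (m + 1), v i ≤ 2 * m + ((q * D : ℕ) : ℝ) := by
    have hD1 : (D : ℝ) ≤ ((q * D : ℕ) : ℝ) := by
      rw [Nat.cast_mul]
      exact le_mul_of_one_le_left (Nat.cast_nonneg D) hq1
    linarith
  exact lifetime_lt (cs := cs / q) (D := q * D) (f := fun i => (q : ℝ) * f i) hce hp hP5' hb' hbA hC d hf' hv hΨ0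
    hfound' hstep' hD' hV' hRmax hσ hint hhalf hlen hR

/-- As `lifetime_lt_flow`, with the rescaled birth unit `q·(2·14^d)` and (P5_q). [folklore] -/
theorem lifetime_lt_flow_rescaled
    {ce cs p₀ b : ℝ} {m D A : ℕ} {q : ℕ} (hq : 1 ≤ q) (hce : 0 < ce) (hp : 0 < p₀) (hP5q : q * ce ≤ cs * p₀)
    (hb : ce * p₀ * m + cs * p₀ ^ 2 * D ≤ b) (hbA : b < ce * p₀ * A)
    {C : ℝ} (hC : 1 ≤ C) (d : ℕ) {Ψ f v : ℕ → ℝ} (hf : ∀ i, 0 ≤ f i) (hv : ∀ i, 0 ≤ v i) (hΨ0 : 0 ≤ Ψ 0)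
    (hfound : Ψ 0 ≤ q * (2 * 14 ^ d) * f 0)
    (hstep : ∀ i, Ψ (i + 1) ≤ C * Ψ i + (q * (2 * 14 ^ d) * f (i + 1) + 2 * d * v (i + 1)))
    (hD : ∑ i ∈ Finset.range (m + 1), f i ≤ D) (hV : ∑ i ∈ Finset.range (m + 1), v i ≤ 2 * m + D)
    {σ : ℕ → ℝ} {d' : ℕ → ℕ → ℝ} {len : ℕ → ℕ}
    (hσ : ∀ i, i ≤ m → ∃ t, t ≤ m ∧ σ i ≤ C * Ψ t)
    (hint : ∀ i, i ≤ m → ∀ k, 0 < d' i k → 1 ≤ d' i k)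
    (hhalf : ∀ i, i ≤ m → ∀ k, 1 < k → d' i k ≤ (1 / 2) ^ k * σ i)
    (F : Flow) (K : ℕ) {β' : ℝ} (hβ' : 0 ≤ β') {L r : ℕ} (hL : 1 ≤ L)
    (hpos : ∀ j, j ≤ K → 0 < F.g j) (hle1 : ∀ j, j ≤ K → F.g j ≤ 1) (hrg : F.SatisfiesRG K)
    (hub : ∀ j, j < K → F.β (j + 1) (F.g j) ≤ β') (R : ℕ → ℕ) (hRj : ∀ j, j ≤ K → B14.IsRj L r (F.g j) (R j))
    {x c : ℝ} (hx : 0 ≤ x) (hc : 0 ≤ c) (hxK : Real.log ((F.g K) ^ 2)⁻¹ ≤ x) (hcK : (F.g K) ^ 2 * β' ≤ c)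
    {s : ℕ → ℕ} (hs : ∀ i, i ≤ m → s i ≤ K)
    (hlen : ∀ i, i ≤ m → ∃ k : ℕ, (k = 0 ∨ 0 < d' i k) ∧ (len i : ℝ) ≤ k + R (s i)) :
    (∑ i ∈ Finset.range (m + 1), (len i : ℝ)) < A * epochAllowance d C (windowMax L r x c K) A :=
  lifetime_lt_rescaled hq hce hp hP5q hb hbA hC d hf hv hΨ0 hfound hstep hD hV (R := fun i => (R (s i) : ℝ))
    (windowMax_nonneg L r hx hc K) hσ hint hhalf hlen
    (fun i hi => window_le_of_flow F K hβ' hL hpos hle1 hrg hub R hRj hxK hcK (hs i hi))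

/-- As `lifetime_lt_youngWindow` (the link (Y3) at a fixed `K`), with the rescaled birth unit and (P5_q). [folklore] -/
theorem lifetime_lt_youngWindow_rescaled
    {ce cs p₀ b : ℝ} {m D : ℕ} {C' : ℝ} {K : ℕ} {q : ℕ} (hq : 1 ≤ q) (hce : 0 < ce) (hp : 0 < p₀)
    (hP5q : q * ce ≤ cs * p₀)
    (hb : ce * p₀ * m + cs * p₀ ^ 2 * D ≤ b) (hbA : b < ce * p₀ * (ageCut C' K))
    {C : ℝ} (hC : 1 ≤ C) (d : ℕ) {Ψ f v : ℕ → ℝ} (hf : ∀ i, 0 ≤ f i) (hv : ∀ i, 0 ≤ v i) (hΨ0 : 0 ≤ Ψ 0)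
    (hfound : Ψ 0 ≤ q * (2 * 14 ^ d) * f 0)
    (hstep : ∀ i, Ψ (i + 1) ≤ C * Ψ i + (q * (2 * 14 ^ d) * f (i + 1) + 2 * d * v (i + 1)))
    (hD : ∑ i ∈ Finset.range (m + 1), f i ≤ D) (hV : ∑ i ∈ Finset.range (m + 1), v i ≤ 2 * m + D)
    {σ : ℕ → ℝ} {d' : ℕ → ℕ → ℝ} {len : ℕ → ℕ}
    (hσ : ∀ i, i ≤ m → ∃ t, t ≤ m ∧ σ i ≤ C * Ψ t)
    (hint : ∀ i, i ≤ m → ∀ k, 0 < d' i k → 1 ≤ d' i k)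
    (hhalf : ∀ i, i ≤ m → ∀ k, 1 < k → d' i k ≤ (1 / 2) ^ k * σ i)
    (F : Flow) {β' : ℝ} (hβ' : 0 ≤ β') {L r : ℕ} (hL : 1 ≤ L)
    (hpos : ∀ j, j ≤ K → 0 < F.g j) (hle1 : ∀ j, j ≤ K → F.g j ≤ 1) (hrg : F.SatisfiesRG K)
    (hub : ∀ j, j < K → F.β (j + 1) (F.g j) ≤ β') (R : ℕ → ℕ) (hRj : ∀ j, j ≤ K → B14.IsRj L r (F.g j) (R j))
    {x c : ℝ} (hx : 0 ≤ x) (hc : 0 ≤ c) (hxK : Real.log ((F.g K) ^ 2)⁻¹ ≤ x) (hcK : (F.g K) ^ 2 * β' ≤ c)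
    {s : ℕ → ℕ} (hs : ∀ i, i ≤ m → s i ≤ K)
    (hlen : ∀ i, i ≤ m → ∃ k : ℕ, (k = 0 ∨ 0 < d' i k) ∧ (len i : ℝ) ≤ k + R (s i)) :
    (∑ i ∈ Finset.range (m + 1), (len i : ℝ)) < youngAllowance d L r C C' x c K ∧
      (∑ i ∈ Finset.range (m + 1), (len i : ℝ)) < (youngWindow d L r C C' x c K : ℝ) := by
  have h := lifetime_lt_flow_rescaled hq hce hp hP5q hb hbA hC d hf hv hΨ0 hfound hstep hD hV hσ hint hhalf F K hβ'
    hL hpos hle1 hrg hub R hRj hx hc hxK hcK hs hlen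
  exact ⟨h, lt_of_lt_of_le h (Nat.le_ceil _)⟩

/-- **THE MODEL INSTANCE (`q = 2`): LEMMA Y's skeleton with the new-part constant `4·14^d`** — the constant of the
sibling leaf `T4Enlargement` (`hnew_collar_three`: (γ) on the collar model) — under (P5₂) `2·c_e ≤ c_s·p̄₀`; same
conclusion `< A·epochAllowance d C R_max A`. [folklore] -/
theorem lifetime_lt_four
    {ce cs p₀ b : ℝ} {m D A : ℕ} (hce : 0 < ce) (hp : 0 < p₀) (hP5₂ : 2 * ce ≤ cs * p₀)
    (hb : ce * p₀ * m + cs * p₀ ^ 2 * D ≤ b) (hbA : b < ce * p₀ * A)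
    {C : ℝ} (hC : 1 ≤ C) (d : ℕ) {Ψ f v : ℕ → ℝ} (hf : ∀ i, 0 ≤ f i) (hv : ∀ i, 0 ≤ v i) (hΨ0 : 0 ≤ Ψ 0)
    (hfound : Ψ 0 ≤ 4 * 14 ^ d * f 0)
    (hstep : ∀ i, Ψ (i + 1) ≤ C * Ψ i + (4 * 14 ^ d * f (i + 1) + 2 * d * v (i + 1)))
    (hD : ∑ i ∈ Finset.range (m + 1), f i ≤ D) (hV : ∑ i ∈ Finset.range (m + 1), v i ≤ 2 * m + D)
    {σ R : ℕ → ℝ} {d' : ℕ → ℕ → ℝ} {len : ℕ → ℕ} {Rmax : ℝ} (hRmax : 0 ≤ Rmax)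
    (hσ : ∀ i, i ≤ m → ∃ t, t ≤ m ∧ σ i ≤ C * Ψ t)
    (hint : ∀ i, i ≤ m → ∀ k, 0 < d' i k → 1 ≤ d' i k)
    (hhalf : ∀ i, i ≤ m → ∀ k, 1 < k → d' i k ≤ (1 / 2) ^ k * σ i)
    (hlen : ∀ i, i ≤ m → ∃ k : ℕ, (k = 0 ∨ 0 < d' i k) ∧ (len i : ℝ) ≤ k + R i)
    (hR : ∀ i, i ≤ m → R i ≤ Rmax) :
    (∑ i ∈ Finset.range (m + 1), (len i : ℝ)) < A * epochAllowance d C Rmax A :=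
  lifetime_lt_rescaled (q := 2) (by norm_num) hce hp (by push_cast; linarith) hb hbA hC d hf hv hΨ0
    (hfound.trans (le_of_eq (by push_cast; ring)))
    (fun i => (hstep i).trans (le_of_eq (by push_cast; ring))) hD hV hRmax hσ hint hhalf hlen hR

/-- THE MODEL INSTANCE of the link (Y3): as `lifetime_lt_youngWindow` with the constant `4·14^d` and (P5₂).
[folklore] -/
theorem lifetime_lt_youngWindow_four
    {ce cs p₀ b : ℝ} {m D : ℕ} {C' : ℝ} {K : ℕ} (hce : 0 < ce) (hp : 0 < p₀) (hP5₂ : 2 * ce ≤ cs * p₀)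
    (hb : ce * p₀ * m + cs * p₀ ^ 2 * D ≤ b) (hbA : b < ce * p₀ * (ageCut C' K))
    {C : ℝ} (hC : 1 ≤ C) (d : ℕ) {Ψ f v : ℕ → ℝ} (hf : ∀ i, 0 ≤ f i) (hv : ∀ i, 0 ≤ v i) (hΨ0 : 0 ≤ Ψ 0)
    (hfound : Ψ 0 ≤ 4 * 14 ^ d * f 0)
    (hstep : ∀ i, Ψ (i + 1) ≤ C * Ψ i + (4 * 14 ^ d * f (i + 1) + 2 * d * v (i + 1)))
    (hD : ∑ i ∈ Finset.range (m + 1), f i ≤ D) (hV : ∑ i ∈ Finset.range (m + 1), v i ≤ 2 * m + D)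
    {σ : ℕ → ℝ} {d' : ℕ → ℕ → ℝ} {len : ℕ → ℕ}
    (hσ : ∀ i, i ≤ m → ∃ t, t ≤ m ∧ σ i ≤ C * Ψ t)
    (hint : ∀ i, i ≤ m → ∀ k, 0 < d' i k → 1 ≤ d' i k)
    (hhalf : ∀ i, i ≤ m → ∀ k, 1 < k → d' i k ≤ (1 / 2) ^ k * σ i)
    (F : Flow) {β' : ℝ} (hβ' : 0 ≤ β') {L r : ℕ} (hL : 1 ≤ L)
    (hpos : ∀ j, j ≤ K → 0 < F.g j) (hle1 : ∀ j, j ≤ K → F.g j ≤ 1) (hrg : F.SatisfiesRG K)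
    (hub : ∀ j, j < K → F.β (j + 1) (F.g j) ≤ β') (R : ℕ → ℕ) (hRj : ∀ j, j ≤ K → B14.IsRj L r (F.g j) (R j))
    {x c : ℝ} (hx : 0 ≤ x) (hc : 0 ≤ c) (hxK : Real.log ((F.g K) ^ 2)⁻¹ ≤ x) (hcK : (F.g K) ^ 2 * β' ≤ c)
    {s : ℕ → ℕ} (hs : ∀ i, i ≤ m → s i ≤ K)
    (hlen : ∀ i, i ≤ m → ∃ k : ℕ, (k = 0 ∨ 0 < d' i k) ∧ (len i : ℝ) ≤ k + R (s i)) :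
    (∑ i ∈ Finset.range (m + 1), (len i : ℝ)) < youngAllowance d L r C C' x c K ∧
      (∑ i ∈ Finset.range (m + 1), (len i : ℝ)) < (youngWindow d L r C C' x c K : ℝ) :=
  lifetime_lt_youngWindow_rescaled (q := 2) (by norm_num) hce hp (by push_cast; linarith) hb hbA hC d hf hv hΨ0
    (hfound.trans (le_of_eq (by push_cast; ring)))
    (fun i => (hstep i).trans (le_of_eq (by push_cast; ring))) hD hV hσ hint hhalf F hβ' hL hpos hle1 hrg hub R
    hRj hx hc hxK hcK hs hlen

/-- SANITY (non-vacuity of `lifetime_lt_four`): the trivial ledger satisfies every hypothesis with `c_e = p̄₀ = 1`,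
`c_s = 2` (so (P5₂) holds with equality), `b = 0`, `A = 1`, `C = 1`, `R_max = 0`. [folklore] -/
example (d : ℕ) :
    (∑ i ∈ Finset.range (0 + 1), ((fun _ : ℕ => (0 : ℕ)) i : ℝ)) < (1 : ℕ) * epochAllowance d 1 0 1 :=
  lifetime_lt_four (ce := 1) (cs := 2) (p₀ := 1) (b := 0) (m := 0) (D := 0) (A := 1) one_pos one_pos (by norm_num)
    (by norm_num) (by norm_num) le_rfl d (Ψ := fun _ => 0) (f := fun _ => 0) (v := fun _ => 0)
    (fun _ => le_rfl) (fun _ => le_rfl) le_rfl (by norm_num) (fun _ => by norm_num) (by simp) (by simp)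
    (σ := fun _ => 0) (R := fun _ => 0) (d' := fun _ _ => 0) (len := fun _ => 0) (Rmax := 0) le_rfl
    (fun i _ => ⟨0, le_rfl, by norm_num⟩) (fun i _ k h => absurd h (lt_irrefl _)) (fun i _ k _ => by simp)
    (fun i _ => ⟨0, Or.inl rfl, by norm_num⟩) (fun _ _ => le_rfl)

/-- SANITY: (P5₂) with a genuine budget — `c_e = 1`, `c_s = 2`, `p̄₀ = 1`, `m = 2`, `D = 1`, `b = 4 < 1·1·5`:
the rescaled bank data of `lifetime_lt_rescaled` (`c_s/2 = 1`, `2D = 2`) still give `m, 2D < A = 5`. [folklore] -/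
example : (2 : ℕ) < 5 ∧ (2 * 1 : ℕ) < 5 :=
  ⟨events_lt_of_bank_lt (ce := 1) (cs := 2 / 2) (p₀ := 1) (b := 4) (m := 2) (D := 2 * 1) (A := 5) one_pos one_pos
      (by norm_num) (by norm_num) (by norm_num),
   births_lt_of_bank_lt (ce := 1) (cs := 2 / 2) (p₀ := 1) (b := 4) (m := 2) (D := 2 * 1) (A := 5) one_pos one_pos
      (by norm_num) (by norm_num) (by norm_num)⟩

end Rescale

end Literature.MathematicalPhysics.QuantumFieldTheory.Balaban1983to89.T4BankAgeYoung
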